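import Summits.BirchSwinnertonDyer.Rank1Residual.X11a.SelmerCompanionTateLineResidueReading
import HarnessLib

/-!
# Route (3e) SELMER COMPANION, XLIII: the residue-field READING of shape G's Kummer point `hpt`
# (class X11a = N7; cell `b2b-bsdres`, unit `b2b-bsdres-x11a`, gen 33)

HONEST FRAMING (run/shared/lean/b2b/bsd-rank1-residual/, verbatim in every file): the goal of the
cell is to DELETE the COMBINATION-SHAPED residual classes of the Birch–Swinnerton-Dyer formula for
ALL analytic-rank `≤ 1` elliptic curves over `ℚ` — "full BSD formula for every rank `≤ 1` curve in
class `C`" assembled STRICTLY from published theorems — so that the rank-`≤ 1` remainder becomes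
exactly the CONSTRUCTION-SHAPED classes, which are TYPED (missing-input `Prop`s), NOT attempted.
This is not "finishing BSD". CLASS-OWNERS.md: research routes; NO CLAIM BEYOND STATED CLASSES.
THEOREMS ONLY; nothing booked; no label moves.

## What this file proves

Companion of file XLII. Lemma G1 (file XXXIV), shape G (file XXXV) and its shape-F twin (file
XXXVIII) take the KUMMER POINT at the full-torsion place `v₀ ∤ p` in the `K̄_v`-level form `hpt`:
*a point `h ∈ A(K̄_v)` whose coboundary `σ ↦ σh − h` is valued in the transported Tate line
`Λ = θΦ'(μ_p)` and is not identically zero*. The census supplies instead a residue WITNESS: a point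
`P̃` of `Ã(𝔽_ℓ)` with `δ⁻¹(P̃) := Frob(μ) − μ ∈ Λ̃ ∖ {O}` for the `p`-th roots `μ` of `P̃`
(`HOME/code/b2b-bsdres-x11a/gen31/…/linestrict*.gp`, column `kummerpoint`). This file proves

* `hpt_of_tateLine_residue_witness` — **`hpt` from the residue witness**: if a `Γ_{ℚ_v}`-fixed
  point `t ∈ A(K̄_v)` (any point of `A(ℚ_v)` lifting `P̃`: Hensel, Silverman VII.2.1) has
  `red₀ t ≠ O` and every affine `c̃ = (a, b)` over the residue field with `p·c̃ = red₀ t` has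
  `(a^q, b^q) ≠ (a, b)` and `(a^q, b^q) − (a, b) = red₀ λ(ζ)` for some `ζ ∈ μ_p`, then `hpt` holds
  verbatim, with `h` a `p`-th root of `t`: the inertia group fixes `h` (good reduction, `v ∤ p`:
  `smul_localPoints_eq_of_mem_inertia_holds`), an arithmetic Frobenius `τ` has `τh − h = λ(ζ)`
  EXACTLY (file XLII §1 + "`p`-torsion of the kernel of reduction is `O`",
  `val_le_one_of_zsmul_eq_zero`), and `{σ | σh − h ∈ ℤ·λ(ζ)}` is an open subgroup containing `τ`
  and inertia, i.e. all of `Γ_{ℚ_v}` (`eq_top_of_isOpen_of_frobenius_mem_of_inertia_le`).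

File XLIV removes the remaining `K̄_v`-level datum `t` (Hensel lift of a point of `Ã(k_v)`), so
that with files XLII–XLIV both finite certificates of the Tate-line rows (shape G: 5 N7 cells @3;
shape F modes lt/nslt: 15 rows) are residue-level statements in the kernel, modulo
`Λ̃ = red₀(Λ)` for the row's `θ` (made explicit by the engines, not here). Binders: none new. Not
a class theorem; nothing booked.

References: [SilvermanAEC2009] VII.2.1, VII.3.1; [SerreLocalFields1979] IV §4; [NeukirchANT1999]
II §9; files XXXIV, XXXV, XXXVIII, XLII; HOME/b2b-bsdres-x11a/REPORT-g33.md.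
-/

set_option autoImplicit false

noncomputable section

open scoped Classical NNReal

open WeierstrassCurve Literature.NumberTheory.EllipticCurves
  Literature.NumberTheory.GaloisRepresentations Field NumberField IsDedekindDomain
  IsDedekindDomain.HeightOneSpectrum Literature.NumberTheory.EllipticCurves.FormalGroupChart
  Literature.NumberTheory.EllipticCurves.Rank1Residual
  Literature.NumberTheory.EllipticCurves.Rank1Residual.Typed

namespace Summit.BirchSwinnertonDyer.Rank1Residual.X11a.SelmerCompanion

variable (A : WeierstrassCurve ℚ) [A.IsGloballyMinimal] (p : ℕ) [hp : Fact p.Prime]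
  {v : HeightOneSpectrum (𝓞 ℚ)}
  {w : Valuation (AlgebraicClosure (v.adicCompletion ℚ)) ℝ≥0}
  (hw : ∀ x, (w x : ℝ) = spectralNorm (v.adicCompletion ℚ) (AlgebraicClosure (v.adicCompletion ℚ)) x)
  (hΔu : IsUnit ((integralModelInt A).map (algebraMap ℤ ↥w.valuationSubring)).Δ)
  (red₀ : localPoints A (v.adicCompletion ℚ) →+
    (((integralModelInt A).map (algebraMap ℤ ↥w.valuationSubring)).map
      (IsLocalRing.residue ↥w.valuationSubring)).toAffine.Point)
  (hred₀ : ∀ P : localPoints A (v.adicCompletion ℚ), red₀ P =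
    ((integralModelInt A).map (algebraMap ℤ ↥w.valuationSubring)).reducePoint
      (Affine.Point.congrEquiv (localIntModel_baseChange A w.valuationSubring).symm P))

/-! ## The Kummer point of shape G from a residue witness -/

include hw hΔu hred₀ in
/-- **Shape G's Kummer point `hpt` from a residue witness.** Setting of §2, with `A` good at `v`
(`hgood`), `v ∤ p` (`hpv`), `θ` equivariant, `Φ'` equivariant (`hequiv'`) and `μ_p ⊂ ℚ_v` (`hμ`,
file XXXV `units_map_eq_self_of_pow_eq_one_of_dvd`). HYPOTHESES (the census's Kummer-point
witness, Hensel-lifted): a `Γ_{ℚ_v}`-FIXED point `t ∈ A(K̄_v)` (e.g. a point of `A(ℚ_v)`) with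
`t̃ := red₀ t ≠ O` (`ht0`) such that every affine point `c̃ = (a, b)` of `Ã` over the residue
field with `p·c̃ = t̃` has `(a^q, b^q) ≠ (a, b)` and `(a^q, b^q) − (a, b) = red₀ λ(ζ)` for some
`ζ ∈ μ_p` (`hwit`). CONCLUSION: the hypothesis `hpt` of files XXXIV/XXXV/XXXVIII verbatim — a point
`h ∈ A(K̄_v)` with `σh − h ∈ {λ(ζ)}` for all `σ ∈ Γ_{ℚ_v}` and `σ₁h ≠ h` for some `σ₁`. PROOF:
`h` = a `p`-th root of `t` (`zsmul_surjective_of_isAlgClosed`); the inertia group fixes `h`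
(`smul_localPoints_eq_of_mem_inertia_holds`: `p(σh − h) = σt − t = O`, good reduction, `v ∤ p`);
for an arithmetic Frobenius `τ`, `d := τh − h` is `p`-torsion and §1 gives
`red₀ d = (x̄^q, ȳ^q) − (x̄, ȳ) = red₀ λ(ζ)`, so `d − λ(ζ)` is a `p`-torsion point of the kernel of
reduction, hence `O` (`val_le_one_of_zsmul_eq_zero`, `|p|_v = 1`): `τh − h = λ(ζ) ≠ O`. The set of
`σ` with `σh − h ∈ ℤ·λ(ζ)` is an open subgroup (`λ(ζ)` is `Γ_{ℚ_v}`-fixed by `hμ`; stabilisers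
are open) containing `τ` and the inertia group, so it is `Γ_{ℚ_v}`
(`eq_top_of_isOpen_of_frobenius_mem_of_inertia_le`); and `k·λ(ζ) = λ(ζ^k)`.
[cite: SilvermanAEC2009, Prop. VII.2.1, Prop. VII.3.1] [cite: SerreLocalFields1979, Ch. IV §4 Prop. 16]
[cite: NeukirchANT1999, Ch. II §9 Prop. (9.9)–(9.11)] -/
theorem hpt_of_tateLine_residue_witness [A.IsElliptic]
    [hV : (A.baseChange (AlgebraicClosure (v.adicCompletion ℚ))).IsIntegral w.integer]
    (hgood : A.HasGoodReductionAt v) (hpv : (p : 𝓞 ℚ) ∉ v.asIdeal)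
    (W : WeierstrassCurve ℚ) [W.IsElliptic] (hn : (p : ℤ) ≠ 0)
    (θ : geomTorsion W (p : ℤ) ≃+ geomTorsion A (p : ℤ))
    (hθ : ∀ (σ : absoluteGaloisGroup ℚ) (P : geomTorsion W (p : ℤ)), θ (σ • P) = σ • θ P)
    (Φ' : Additive (AlgebraicClosure (v.adicCompletion ℚ))ˣ →+ localPoints W (v.adicCompletion ℚ))
    (hequiv' : ∀ (σ : absoluteGaloisGroup (v.adicCompletion ℚ))
        (u : (AlgebraicClosure (v.adicCompletion ℚ))ˣ),
      σ • Φ' (Additive.ofMul u) = Φ' (Additive.ofMul (Units.map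
        (absoluteGaloisGroup.toAlgEquiv _ σ : AlgebraicClosure (v.adicCompletion ℚ) →*
          AlgebraicClosure (v.adicCompletion ℚ)) u)))
    (hμ : ∀ (σ : absoluteGaloisGroup (v.adicCompletion ℚ))
        (ζ : (AlgebraicClosure (v.adicCompletion ℚ))ˣ), ζ ^ p = 1 →
      Units.map (absoluteGaloisGroup.toAlgEquiv _ σ : AlgebraicClosure (v.adicCompletion ℚ) →*
        AlgebraicClosure (v.adicCompletion ℚ)) ζ = ζ)
    (t : localPoints A (v.adicCompletion ℚ))
    (htfix : ∀ σ : absoluteGaloisGroup (v.adicCompletion ℚ), σ • t = t) (ht0 : red₀ t ≠ 0)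
    (hwit : ∀ (a b : IsLocalRing.ResidueField ↥w.valuationSubring)
        (hab : (((integralModelInt A).map (algebraMap ℤ ↥w.valuationSubring)).map
          (IsLocalRing.residue ↥w.valuationSubring)).toAffine.Nonsingular a b)
        (habq : (((integralModelInt A).map (algebraMap ℤ ↥w.valuationSubring)).map
          (IsLocalRing.residue ↥w.valuationSubring)).toAffine.Nonsingular
          (a ^ Nat.card (IsLocalRing.ResidueField (v.adicCompletionIntegers ℚ)))
          (b ^ Nat.card (IsLocalRing.ResidueField (v.adicCompletionIntegers ℚ)))),
      (p : ℤ) • (Affine.Point.some a b hab) = red₀ t →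
      Affine.Point.some _ _ habq ≠ Affine.Point.some a b hab ∧
      ∃ (ζ : (AlgebraicClosure (v.adicCompletion ℚ))ˣ) (_ : ζ ^ p = 1)
        (hζ : Φ' (Additive.ofMul ζ) ∈
            AddSubgroup.torsionBy (localPoints W (v.adicCompletion ℚ)) (p : ℤ)),
          (Affine.Point.some _ _ habq) - (Affine.Point.some a b hab) =
            red₀ (pointsMap A (v.adicCompletion ℚ)
              ((θ ((W.torsionPointsEquiv (p : ℤ) (E := v.adicCompletion ℚ) hn).symm
                ⟨Φ' (Additive.ofMul ζ), hζ⟩) : geomTorsion A (p : ℤ)) : geomPoints A))) :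
    ∃ h : localPoints A (v.adicCompletion ℚ),
      (∀ σ : absoluteGaloisGroup (v.adicCompletion ℚ),
        ∃ (ζ : (AlgebraicClosure (v.adicCompletion ℚ))ˣ) (_ : ζ ^ p = 1)
          (hζ : Φ' (Additive.ofMul ζ) ∈
            AddSubgroup.torsionBy (localPoints W (v.adicCompletion ℚ)) (p : ℤ)),
          σ • h - h = pointsMap A (v.adicCompletion ℚ)
            ((θ ((W.torsionPointsEquiv (p : ℤ) (E := v.adicCompletion ℚ) hn).symm
              ⟨Φ' (Additive.ofMul ζ), hζ⟩) : geomTorsion A (p : ℤ)) : geomPoints A)) ∧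
      ∃ σ₁ : absoluteGaloisGroup (v.adicCompletion ℚ), σ₁ • h ≠ h := by
  have hpp : p.Prime := hp.out
  obtain ⟨𝔐, h𝔐⟩ := v.localPrimesAbove_nonempty
  obtain ⟨τ, hτ⟩ := v.exists_isArithFrobAt_localAbsIntegers h𝔐
  -- the transport `G : E(K̄_v)[p] → A(K̄_v)` and its equivariance (as in file XXXIV)
  set e' := W.torsionPointsEquiv (p : ℤ) (E := (v.adicCompletion ℚ)) hn with he'
  set G : AddSubgroup.torsionBy (localPoints W (v.adicCompletion ℚ)) (p : ℤ) →+ localPoints A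
      (v.adicCompletion ℚ) :=
    ((pointsMap A (v.adicCompletion ℚ)).comp (geomTorsion A (p : ℤ)).subtype).comp
      (θ.toAddMonoidHom.comp e'.symm.toAddMonoidHom) with hG
  have hG_apply : ∀ T, G T = pointsMap A (v.adicCompletion ℚ) ((θ (e'.symm T) : geomTorsion A
      (p : ℤ)) : geomPoints A) := fun T ↦ rfl
  have hGsmul : ∀ (σ : (absoluteGaloisGroup (v.adicCompletion ℚ))) (T : AddSubgroup.torsionBy
      (localPoints W (v.adicCompletion ℚ)) (p : ℤ)),
      G (σ • T) = σ • G T := by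
    intro σ T
    rw [hG_apply, hG_apply, he', torsionPointsEquiv_symm_smul, hθ,
      Literature.NumberTheory.EllipticCurves.AddSubgroup.torsionBy.coe_smul, pointsMap_smul]
  have hmem' : ∀ {ζ : (AlgebraicClosure (v.adicCompletion ℚ))ˣ}, ζ ^ p = 1 →
      Φ' (Additive.ofMul ζ) ∈ AddSubgroup.torsionBy (localPoints W (v.adicCompletion ℚ)) (p : ℤ) :=
    fun hζ ↦ (Submodule.mem_torsionBy_iff _ _).mpr
        (W.zsmul_map_ofMul_eq_zero_of_pow_eq_one v Φ' hζ)
  have hGfix : ∀ (σ : absoluteGaloisGroup (v.adicCompletion ℚ))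
      (ζ : (AlgebraicClosure (v.adicCompletion ℚ))ˣ) (hζp : ζ ^ p = 1) (hζ : Φ' (Additive.ofMul ζ) ∈
        AddSubgroup.torsionBy (localPoints W (v.adicCompletion ℚ)) (p : ℤ)),
      σ • G ⟨Φ' (Additive.ofMul ζ), hζ⟩ = G ⟨Φ' (Additive.ofMul ζ), hζ⟩ := by
    intro σ ζ hζp hζ
    have h1 : σ • (⟨Φ' (Additive.ofMul ζ), hζ⟩ : AddSubgroup.torsionBy (localPoints W
        (v.adicCompletion ℚ)) (p : ℤ)) = ⟨Φ' (Additive.ofMul ζ), hζ⟩ := Subtype.ext (by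
      rw [Literature.NumberTheory.EllipticCurves.AddSubgroup.torsionBy.coe_smul]
      change σ • Φ' (Additive.ofMul ζ) = Φ' (Additive.ofMul ζ)
      rw [hequiv', hμ σ ζ hζp])
    rw [← hGsmul, h1]
  have hGp : ∀ T, (p : ℤ) • G T = 0 := fun T ↦ by
    have h0 : (p : ℤ) • T = 0 := Subtype.ext (by
      rw [AddSubgroupClass.coe_zsmul, AddSubgroup.coe_zero]
      exact (Submodule.mem_torsionBy_iff _ _).mp T.2)
    rw [← map_zsmul, h0, map_zero]
  have hGpow : ∀ (ζ : (AlgebraicClosure (v.adicCompletion ℚ))ˣ) (hζp : ζ ^ p = 1)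
      (hζ : Φ' (Additive.ofMul ζ) ∈ AddSubgroup.torsionBy (localPoints W (v.adicCompletion ℚ)) (p : ℤ))
      (k : ℤ), ∃ (hζkp : (ζ ^ k) ^ p = 1),
        G ⟨Φ' (Additive.ofMul (ζ ^ k)), hmem' hζkp⟩ = k • G ⟨Φ' (Additive.ofMul ζ), hζ⟩ := by
    intro ζ hζp hζ k
    have hζkp : (ζ ^ k) ^ p = 1 := by
      rw [← zpow_natCast, ← zpow_mul, mul_comm, zpow_mul, zpow_natCast, hζp, one_zpow]
    refine ⟨hζkp, ?_⟩
    rw [← map_zsmul]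
    congr 1
    exact Subtype.ext (by
      rw [AddSubgroupClass.coe_zsmul]
      change Φ' (Additive.ofMul (ζ ^ k)) = k • Φ' (Additive.ofMul ζ)
      rw [ofMul_zpow, map_zsmul])
  -- a `p`-th root `H` of `t`; the inertia group fixes it
  obtain ⟨H, hH⟩ : ∃ H : localPoints A (v.adicCompletion ℚ), (p : ℤ) • H = t :=
    (A.baseChange (AlgebraicClosure (v.adicCompletion ℚ))).zsmul_surjective_of_isAlgClosed hn t
  have hv' : v ∉ A.badPlaces (𝓞 ℚ) := fun hb ↦ hb hgood
  have hpv' : ((p : ℤ) : 𝓞 ℚ) ∉ v.asIdeal := by rwa [Int.cast_natCast]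
  have hI : ∀ i ∈ 𝔐.inertia (absoluteGaloisGroup (v.adicCompletion ℚ)), i • H = H := fun i hi ↦
    A.smul_localPoints_eq_of_mem_inertia_holds v hv' hpv' h𝔐 hi (by
      rw [zsmul_sub, ← smul_zsmul_localPoints, hH, htfix i, sub_self])
  -- `H` is integral with non-zero reduction
  have hH0 : red₀ H ≠ 0 := fun h' ↦ ht0 (by rw [← hH, map_zsmul, h', zsmul_zero])
  have hHK : ((H : localPoints A (v.adicCompletion ℚ)) :
      (A.baseChange (AlgebraicClosure (v.adicCompletion ℚ))).toAffine.Point) ∉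
      kernel w (A.baseChange (AlgebraicClosure (v.adicCompletion ℚ))) :=
    fun hk ↦ hH0 ((A.localRed_eq_zero_iff_mem_kernel hΔu red₀ hred₀ H).mpr hk)
  obtain ⟨x, y, hxy, rfl⟩ : ∃ x y hxy, H = (show localPoints A (v.adicCompletion ℚ) from
      Affine.Point.some x y hxy) := by
    change (A.baseChange (AlgebraicClosure (v.adicCompletion ℚ))).toAffine.Point at H
    rcases H with _ | ⟨x, y, hxy⟩
    · exact (hH0 (map_zero red₀)).elim
    · exact ⟨x, y, hxy, rfl⟩
  set H : localPoints A (v.adicCompletion ℚ) := (show localPoints A (v.adicCompletion ℚ) from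
      Affine.Point.some x y hxy) with hHdef
  have hx : w x ≤ 1 := by
    by_contra hx
    exact hHK ((some_mem_kernel_iff (w := w) hxy).mpr (not_le.mp hx))
  obtain ⟨hy, hns, hnsq, e₁, e₂⟩ := localRed_smul_frobenius A hw hΔu red₀ hred₀ h𝔐 hτ (h := hxy) hx
  -- the residue witness at `H̃`
  have hpH : (p : ℤ) • (Affine.Point.some _ _ hns) = red₀ t := by rw [← e₁, ← map_zsmul, hH]
  obtain ⟨hne, ζ, hζp, hζ, heq⟩ := hwit _ _ hns hnsq hpH
  set L : localPoints A (v.adicCompletion ℚ) := G ⟨Φ' (Additive.ofMul ζ), hζ⟩ with hL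
  have hL0 : L ≠ 0 := by
    intro h0
    apply hne
    rw [← sub_eq_zero, heq, ← hG_apply, ← hL, h0, map_zero]
  have hLfix : ∀ σ : absoluteGaloisGroup (v.adicCompletion ℚ), σ • L = L :=
    fun σ ↦ hGfix σ ζ hζp hζ
  -- `p`-torsion points of the kernel of reduction vanish (`|p|_v = 1`)
  have hN1 : w ((p : ℤ) : AlgebraicClosure (v.adicCompletion ℚ)) = 1 :=
    spectralValuation_intCast_eq_one hw hpv'
  have aux : ∀ P : localPoints A (v.adicCompletion ℚ), red₀ P = 0 → (p : ℤ) • P = 0 → P = 0 := by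
    intro P hP0 hPp
    have hk : ((P : localPoints A (v.adicCompletion ℚ)) :
        (A.baseChange (AlgebraicClosure (v.adicCompletion ℚ))).toAffine.Point) ∈
        kernel w (A.baseChange (AlgebraicClosure (v.adicCompletion ℚ))) :=
      (A.localRed_eq_zero_iff_mem_kernel hΔu red₀ hred₀ P).mp hP0
    change (A.baseChange (AlgebraicClosure (v.adicCompletion ℚ))).toAffine.Point at P
    rcases P with _ | ⟨x', y', h'⟩
    · rfl
    · exact absurd (val_le_one_of_zsmul_eq_zero hN1 hPp)
        (not_le.mpr ((some_mem_kernel_iff (w := w) h').mp hk))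
  -- `τH − H = L`: the difference is a `p`-torsion point of the kernel of reduction
  have hd : τ • H - H = L := by
    have hred : red₀ (τ • H - H - L) = 0 := by
      rw [map_sub, map_sub, e₂, e₁, hL, hG_apply, ← heq, sub_self]
    have hp0 : (p : ℤ) • (τ • H - H - L) = 0 := by
      rw [zsmul_sub, zsmul_sub, ← smul_zsmul_localPoints, hH, htfix τ, sub_self, zero_sub,
        neg_eq_zero, hL]
      exact hGp _
    exact sub_eq_zero.mp (aux _ hred hp0)
  -- the open subgroup `U = {σ | σH − H ∈ ℤ·L}` contains `τ` and the inertia group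
  have hZfix : ∀ (σ : absoluteGaloisGroup (v.adicCompletion ℚ)) (z : localPoints A
      (v.adicCompletion ℚ)), z ∈ AddSubgroup.zmultiples L → σ • z = z := by
    intro σ z hz
    obtain ⟨k, rfl⟩ := AddSubgroup.mem_zmultiples_iff.mp hz
    rw [smul_zsmul_localPoints, hLfix]
  let U : Subgroup (absoluteGaloisGroup (v.adicCompletion ℚ)) :=
    { carrier := {σ | σ • H - H ∈ AddSubgroup.zmultiples L}
      one_mem' := by
        show (1 : absoluteGaloisGroup (v.adicCompletion ℚ)) • H - H ∈ AddSubgroup.zmultiples L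
        rw [one_smul, sub_self]; exact zero_mem _
      mul_mem' := by
        intro σ ρ hσ hρ
        have hρ' : ρ • H - H ∈ AddSubgroup.zmultiples L := hρ
        have hσ' : σ • H - H ∈ AddSubgroup.zmultiples L := hσ
        show (σ * ρ) • H - H ∈ AddSubgroup.zmultiples L
        have e : (σ * ρ) • H - H = σ • (ρ • H - H) + (σ • H - H) := by
          rw [mul_smul, smul_sub]; abel
        rw [e, hZfix σ _ hρ']
        exact add_mem hρ' hσ'
      inv_mem' := by
        intro σ hσ
        have hσ' : σ • H - H ∈ AddSubgroup.zmultiples L := hσ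
        show σ⁻¹ • H - H ∈ AddSubgroup.zmultiples L
        have e : σ⁻¹ • H - H = -(σ⁻¹ • (σ • H - H)) := by
          rw [smul_sub, inv_smul_smul]; abel
        rw [e, hZfix σ⁻¹ _ hσ']
        exact neg_mem hσ' }
  have hUmem : ∀ σ : absoluteGaloisGroup (v.adicCompletion ℚ),
      σ ∈ U ↔ σ • H - H ∈ AddSubgroup.zmultiples L := fun σ ↦ Iff.rfl
  have hUle : MulAction.stabilizer (absoluteGaloisGroup (v.adicCompletion ℚ)) H ≤ U := by
    intro σ hσ
    rw [hUmem, MulAction.mem_stabilizer_iff.mp hσ, sub_self]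
    exact zero_mem _
  have hUopen : IsOpen (U : Set (absoluteGaloisGroup (v.adicCompletion ℚ))) :=
    Subgroup.isOpen_mono hUle (A.isOpen_stabilizer_localPoints (v.adicCompletion ℚ) H)
  have hτU : τ ∈ U := by
    rw [hUmem, hd]; exact AddSubgroup.mem_zmultiples L
  have hIU : 𝔐.inertia (absoluteGaloisGroup (v.adicCompletion ℚ)) ≤ U := fun i hi ↦ by
    rw [hUmem, hI i hi, sub_self]; exact zero_mem _
  have hU := v.eq_top_of_isOpen_of_frobenius_mem_of_inertia_le h𝔐 hτ hUopen hτU hIU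
  refine ⟨H, fun σ ↦ ?_, τ, fun h' ↦ hL0 (by rw [← hd, h', sub_self])⟩
  have hσ : σ ∈ U := by rw [hU]; trivial
  obtain ⟨k, hk⟩ := AddSubgroup.mem_zmultiples_iff.mp ((hUmem σ).mp hσ)
  obtain ⟨hζkp, hGk⟩ := hGpow ζ hζp hζ k
  refine ⟨ζ ^ k, hζkp, hmem' hζkp, ?_⟩
  rw [← hk, ← hG_apply, hGk]

end Summit.BirchSwinnertonDyer.Rank1Residual.X11a.SelmerCompanion

end
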